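import Summits.CriticalPhenomena.PercolationContinuityZ3.Theorems.PercNearOneGluingNoHeavyLowerTailCILBlobsNoLightPair
import Summits.CriticalPhenomena.PercolationContinuityZ3.Theorems.PercNearOneGluingNoHeavyLowerTailGuardedBlockLonelyRelay
import HarnessLib

/-!
# `NoHeavyLowerTail` (stmt-CriticalPhenomena-4575) — the cumulative isolation lemma on blob structures, IV:
# every two blobs have a LIGHT complement (any number of blobs); the level `j = |A| − 2` for every `A`

Support file (depth prover nh-dp-blobmono; `--supports stmt-CriticalPhenomena-4575`).  No definitions, no
named facts, no sorries.  Notation as in parts I–III: `μ = prodBernoulli w`, relays `A`, observer `o`,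
`N = |π(o)|`, `π(v) = {x ∈ A : v ↔ x}`, blob structure `cls : Fin n → Fin b` (same label on `insert o A` ⇒
joined a.s.), blobs `B_ℓ = A ∩ cls⁻¹ ℓ`, masses `m_ℓ`, level `j`, light = mass `≤ j`.

* `cumulativeIsolation_blobs_coLightPairs` — ANY number of blobs: if every two distinct nonempty relay
  blobs have a light complement (`|A| ≤ j + m_ℓ + m_ℓ'`), then `∃ a ∈ A, μ{1 ≤ N ≤ j} ≤ μ{|π(a)| ≤ j}`.
  This is the lead's `…CILFour` mechanism (`|A| = 4`, `j = 2`) run on blocks: with `y` a relay of the blob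
  `ℓ*` maximising `h(ℓ) = μ{B_ℓ ↮ A∖B_ℓ, A∖B_ℓ pairwise joined}` among the light blobs with heavy
  complement, on `{1 ≤ N ≤ j} ∖ {|π(y)| ≤ j}` the hypothesis forces `π(o)` to be ONE blob `B_ℓ`
  (`ℓ ≠ ℓ*`) with everything else glued to `y`; the guarded block lonely relay lemma
  (`Theorems.guardedBlockLonelyRelay`, Kozma–Nitzan Lemma 1(ii)+2 = BHK Thm 1.5 for sets + Thm 1.3, guards
  "`A ∖ B_ℓ` pairwise joined") gives `Σ_ℓ μ(G_ℓ) ≤ h(ℓ*)`, and `{h(ℓ*)-event} ∖ G_{ℓ*}` lies in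
  `{|π(y)| ≤ j} ∖ {1 ≤ N ≤ j}`.
* `cumulativeIsolation_level_ge_card_sub_two` — singleton blobs: the registered signature of
  `stub_cumulativeIsolation` at every level `j ≥ |A| − 2`, for EVERY `A` (levels `≥ |A| − 1` are the extreme
  case of `…CILSmall`; `j = |A| − 2` is new for `|A| ≥ 5`).  So the open levels of CIL are exactly
  `2 ≤ j ≤ |A| − 3`, the first being `|A| = 5`, `j = 2`.

Blob families covered (five blobs): equal masses `(k,k,k,k)` at levels `2k ≤ j < 3k` (all pairs light, all
triples heavy) — `…CILFour` is `k = 1`.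
-/

noncomputable section

namespace Summit.CriticalPhenomena.PercolationContinuityZ3.Theorems

open MeasureTheory Set Literature.Probability.LatticeModels Literature.Probability.Percolation
open scoped Classical BigOperators

variable {n : ℕ}

open CILBlobs in
/-- **CIL when every two blobs have a light complement (any number of blobs, every `|A|`).**
[cite: KozmaNitzan2024, Lemmas 1–2 (pp. 5–6); VandenbergHaggstromKahn2005, Thms. 1.3, 1.5 — via
Theorems.guardedBlockLonelyRelay] -/
theorem cumulativeIsolation_blobs_coLightPairs {b : ℕ} (w : Sym2 (Fin n) → unitInterval)
    (A : Finset (Fin n)) (o : Fin n) (j : ℕ) (cls : Fin n → Fin b)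
    (hcls : ∀ u ∈ insert o A, ∀ v ∈ insert o A, cls u = cls v →
      (prodBernoulli w).real (openConn u v)ᶜ = 0)
    (hco : ∀ ℓ ℓ' : Fin b, ℓ ≠ ℓ' → (A.filter fun a => cls a = ℓ).Nonempty →
      (A.filter fun a => cls a = ℓ').Nonempty →
      A.card ≤ j + (A.filter fun a => cls a = ℓ).card + (A.filter fun a => cls a = ℓ').card)
    (hA : A.Nonempty) :
    ∃ a ∈ A, (prodBernoulli w).real {ω : BondConfig (Fin n) |
        1 ≤ (A.filter fun y => ω ∈ openConn o y).card ∧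
          (A.filter fun y => ω ∈ openConn o y).card ≤ j} ≤
      (prodBernoulli w).real {ω : BondConfig (Fin n) |
        (A.filter fun y => ω ∈ openConn a y).card ≤ j} := by
  set μ := prodBernoulli w with hμ
  set L := {ω : BondConfig (Fin n) | 1 ≤ (A.filter fun y => ω ∈ openConn o y).card ∧
    (A.filter fun y => ω ∈ openConn o y).card ≤ j} with hL
  set Bl : Fin b → Finset (Fin n) := fun ℓ => A.filter fun a => cls a = ℓ with hBl
  set G := {ω : BondConfig (Fin n) | ∀ u ∈ insert o A, ∀ v ∈ insert o A,
      cls u = cls v → (openGraph ω).Reachable u v} with hG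
  have hGc : μ.real Gᶜ = 0 := blobs_goodSet_compl_null w A o cls hcls
  -- blocks: light nonempty blobs with heavy complement
  set Λ : Finset (Fin b) := Finset.univ.filter fun ℓ =>
    (Bl ℓ).Nonempty ∧ (Bl ℓ).card ≤ j ∧ j + (Bl ℓ).card < A.card with hΛ
  -- block events
  set D : Finset (Fin n) → Set (BondConfig (Fin n)) :=
    fun B => {ω | ∀ b' ∈ B, ∀ a ∈ A \ B, ω ∉ openConn b' a} with hD
  set Q : Finset (Fin n) → Set (BondConfig (Fin n)) :=
    fun B => {ω | ∀ t ∈ (↑(A \ B) : Set (Fin n)), ∀ t' ∈ (↑(A \ B) : Set (Fin n)), ω ∈ openConn t t'}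
    with hQ
  set Gl : Finset (Fin n) → Set (BondConfig (Fin n)) :=
    fun B => {ω | ∃ b' ∈ B, ω ∈ openConn o b'} ∩ D B ∩ Q B with hGl
  -- key containment: off `R_y`, the minority event is a block event of a blob other than `y`'s
  have hkey : ∀ {y : Fin n}, y ∈ A → ∀ ω ∈ (L \ {ω : BondConfig (Fin n) |
      (A.filter fun x => ω ∈ openConn y x).card ≤ j}) ∩ G,
      ∃ ℓ ∈ Λ, ℓ ≠ cls y ∧ ω ∈ Gl (Bl ℓ) := by
    intro y hyA ω hω
    obtain ⟨⟨⟨h1, hj⟩, hR⟩, hωG⟩ := hω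
    simp only [mem_setOf_eq, not_le] at hR
    -- `o ↮ y`, so `π(o)` and `π(y)` are disjoint
    have hoy : ¬ (openGraph ω).Reachable o y := fun h => by
      rw [piCard_eq_of_reachable A o y ω h] at hR; omega
    have hdisj : Disjoint (A.filter fun x => ω ∈ openConn o x) (A.filter fun x => ω ∈ openConn y x) := by
      rw [Finset.disjoint_left]
      intro x hxo hxy
      exact hoy ((Finset.mem_filter.1 hxo).2.trans (SimpleGraph.Reachable.symm (Finset.mem_filter.1 hxy).2))
    have hsum : (A.filter fun x => ω ∈ openConn o x).card + (A.filter fun x => ω ∈ openConn y x).card ≤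
        A.card := by
      rw [← Finset.card_union_of_disjoint hdisj]
      exact Finset.card_le_card (Finset.union_subset (Finset.filter_subset _ _) (Finset.filter_subset _ _))
    obtain ⟨a₀, ha₀⟩ := Finset.card_pos.1 (by omega : 0 < (A.filter fun x => ω ∈ openConn o x).card)
    obtain ⟨ha₀A, hoa₀⟩ := Finset.mem_filter.1 ha₀
    have hoa₀' : (openGraph ω).Reachable o a₀ := hoa₀
    have ha₀B : a₀ ∈ Bl (cls a₀) := Finset.mem_filter.2 ⟨ha₀A, rfl⟩
    have hmℓ : (Bl (cls a₀)).card ≤ (A.filter fun x => ω ∈ openConn o x).card :=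
      blobs_count_ge_one A o cls ω hωG ha₀A hoa₀'
    have hB0 : Bl (cls a₀) ⊆ A := Finset.filter_subset _ _
    have hc0 : (A \ Bl (cls a₀)).card = A.card - (Bl (cls a₀)).card := Finset.card_sdiff_of_subset hB0
    have hm0 : (Bl (cls a₀)).card ≤ A.card := Finset.card_le_card hB0
    -- `π(y)` avoids the blob of any relay it misses; missing a relay outside `B_ℓ` contradicts (co-light)
    have hfull : ∀ t ∈ A \ Bl (cls a₀), (openGraph ω).Reachable y t := by
      intro t ht
      obtain ⟨htA, htB⟩ := Finset.mem_sdiff.1 ht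
      by_contra hyt
      have hct : cls t ≠ cls a₀ := fun h => htB (Finset.mem_filter.2 ⟨htA, h⟩)
      have hav := pi_avoids_label A o cls ω hωG htA hyt
      -- `π(y) ⊆ A \ (B_{cls a₀} ∪ B_{cls t})`
      have hsub : (A.filter fun x => ω ∈ openConn y x) ⊆ (A \ Bl (cls a₀)) \ Bl (cls t) := by
        intro x hx
        obtain ⟨hxA, hyx⟩ := Finset.mem_filter.1 hx
        refine Finset.mem_sdiff.2 ⟨Finset.mem_sdiff.2 ⟨hxA, fun hxB => ?_⟩, fun hxB => ?_⟩
        · -- `x` in the blob of `a₀` would join `y` to `o`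
          have hxa₀ : cls x = cls a₀ := (Finset.mem_filter.1 hxB).2
          have hyx' : (openGraph ω).Reachable y x := hyx
          exact hoy ((reach_of_block A o cls ω hωG ha₀A hxA hoa₀' hxa₀
            (SimpleGraph.Reachable.refl x)).trans hyx'.symm)
        · exact hav x hx (Finset.mem_filter.1 hxB).2
      have hcard : (A.filter fun x => ω ∈ openConn y x).card ≤ ((A \ Bl (cls a₀)) \ Bl (cls t)).card :=
        Finset.card_le_card hsub
      have hBt : Bl (cls t) ⊆ A \ Bl (cls a₀) := fun x hx =>
        Finset.mem_sdiff.2 ⟨(Finset.mem_filter.1 hx).1, fun hx' =>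
          hct ((Finset.mem_filter.1 hx).2.symm.trans (Finset.mem_filter.1 hx').2)⟩
      have hc1 : ((A \ Bl (cls a₀)) \ Bl (cls t)).card = (A \ Bl (cls a₀)).card - (Bl (cls t)).card :=
        Finset.card_sdiff_of_subset hBt
      have hm2 : (Bl (cls t)).card ≤ (A \ Bl (cls a₀)).card := Finset.card_le_card hBt
      have hco' : A.card ≤ j + (Bl (cls a₀)).card + (Bl (cls t)).card :=
        hco (cls a₀) (cls t) hct.symm ⟨a₀, ha₀B⟩ ⟨t, Finset.mem_filter.2 ⟨htA, rfl⟩⟩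
      omega
    -- the block of `a₀` is isolated from the rest
    have hDl : ω ∈ D (Bl (cls a₀)) := by
      intro b' hb' a ha hba
      obtain ⟨hb'A, hcb'⟩ := Finset.mem_filter.1 hb'
      have hoa : (openGraph ω).Reachable o a := reach_of_block A o cls ω hωG ha₀A hb'A hoa₀' hcb' hba
      exact hoy (hoa.trans (hfull a ha).symm)
    have hQl : ω ∈ Q (Bl (cls a₀)) := by
      intro t ht t' ht'
      exact ((hfull t ht).symm.trans (hfull t' ht') : (openGraph ω).Reachable t t')
    -- heavy complement: `π(y) ⊆ A \ B_ℓ` has more than `j` relays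
    have hysub : (A.filter fun x => ω ∈ openConn y x) ⊆ A \ Bl (cls a₀) := by
      intro x hx
      obtain ⟨hxA, hyx⟩ := Finset.mem_filter.1 hx
      refine Finset.mem_sdiff.2 ⟨hxA, fun hxB => ?_⟩
      have hyx' : (openGraph ω).Reachable y x := hyx
      exact hoy ((reach_of_block A o cls ω hωG ha₀A hxA hoa₀' (Finset.mem_filter.1 hxB).2
        (SimpleGraph.Reachable.refl x)).trans hyx'.symm)
    have hheavy : j + (Bl (cls a₀)).card < A.card := by
      have hcard : (A.filter fun x => ω ∈ openConn y x).card ≤ (A \ Bl (cls a₀)).card :=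
        Finset.card_le_card hysub
      omega
    refine ⟨cls a₀, Finset.mem_filter.2 ⟨Finset.mem_univ _, ⟨a₀, ha₀B⟩, le_trans hmℓ hj, hheavy⟩,
      fun h => ?_, ⟨⟨a₀, ha₀B, hoa₀⟩, hDl⟩, hQl⟩
    -- `ℓ ≠ cls y`: `y` is not in the blob of `a₀`
    have hyB : y ∈ A \ Bl (cls a₀) := hysub (Finset.mem_filter.2 ⟨hyA,
      (SimpleGraph.Reachable.refl y : (openGraph ω).Reachable y y)⟩)
    exact (Finset.mem_sdiff.1 hyB).2 (Finset.mem_filter.2 ⟨hyA, h.symm⟩)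
  by_cases hΛ : Λ.Nonempty
  swap
  · -- no block: `L ⊆ R_a` a.s. for any relay
    obtain ⟨a, ha⟩ := hA
    refine ⟨a, ha, oneCut_of_blobs_trap w A o _ cls hcls L _ (fun ω hω => ?_) le_rfl⟩
    by_contra hR
    obtain ⟨ℓ, hℓ, -⟩ := hkey ha ω ⟨⟨hω.1, hR⟩, hω.2⟩
    exact hΛ ⟨ℓ, hℓ⟩
  obtain ⟨ℓs, hℓs, hmax⟩ := Finset.exists_max_image Λ (fun ℓ => μ.real (D (Bl ℓ) ∩ Q (Bl ℓ))) hΛ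
  obtain ⟨hne, hlight, hheavy⟩ := (Finset.mem_filter.1 hℓs).2
  obtain ⟨y, hy⟩ := hne
  obtain ⟨hyA, hcy⟩ := Finset.mem_filter.1 hy
  refine ⟨y, hyA, ?_⟩
  set R := {ω : BondConfig (Fin n) | (A.filter fun x => ω ∈ openConn y x).card ≤ j} with hR
  set t := μ.real (D (Bl ℓs) ∩ Q (Bl ℓs)) with ht
  -- the guarded block lonely relay lemma
  have hinj : ∀ ℓ ∈ Λ, ∀ ℓ' ∈ Λ, Bl ℓ = Bl ℓ' → ℓ = ℓ' := by
    intro ℓ hℓ ℓ' _ hBB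
    obtain ⟨⟨a, ha⟩, -⟩ := (Finset.mem_filter.1 hℓ).2
    have ha' : a ∈ Bl ℓ' := hBB ▸ ha
    exact (Finset.mem_filter.1 ha).2.symm.trans (Finset.mem_filter.1 ha').2
  have hsubA : ∀ B ∈ Λ.image Bl, B ⊆ A := by
    intro B hB
    obtain ⟨ℓ, -, rfl⟩ := Finset.mem_image.1 hB
    exact Finset.filter_subset _ _
  have hdisjB : ∀ B' ∈ Λ.image Bl, ∀ B'' ∈ Λ.image Bl, B' ≠ B'' → Disjoint B' B'' := by
    intro B' hB' B'' hB'' hne'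
    obtain ⟨ℓ', -, rfl⟩ := Finset.mem_image.1 hB'
    obtain ⟨ℓ'', -, rfl⟩ := Finset.mem_image.1 hB''
    have hll : ℓ' ≠ ℓ'' := fun h => hne' (by rw [h])
    exact Finset.disjoint_filter.2 fun a _ h1 h2 => hll (h1.symm.trans h2)
  have hsumle : ∑ B ∈ Λ.image Bl, μ.real (Gl B) ≤ t := by
    have h := guardedBlockLonelyRelay w A o (Λ.image Bl) hsubA hdisjB Q
      (fun B _ => ⟨_, GuardedLonelyRelay.connAllFn_monotone _,
        GuardedLonelyRelay.connAllFn_biUnion_openEdgeCluster _⟩)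
      t measureReal_nonneg (fun B hB => by
        obtain ⟨ℓ, hℓ, rfl⟩ := Finset.mem_image.1 hB
        exact hmax ℓ hℓ)
    exact h
  have hsumΛ : ∑ ℓ ∈ Λ, μ.real (Gl (Bl ℓ)) ≤ t :=
    calc ∑ ℓ ∈ Λ, μ.real (Gl (Bl ℓ)) = ∑ B ∈ Λ.image Bl, μ.real (Gl B) := by rw [Finset.sum_image hinj]
      _ ≤ t := hsumle
  -- `μ(L \ R) ≤ Σ_{ℓ ≠ ℓs} μ(G_ℓ)`
  have hLR : μ.real (L \ R) ≤ ∑ ℓ ∈ Λ.erase ℓs, μ.real (Gl (Bl ℓ)) := by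
    have hsub : (L \ R) ∩ G ⊆ ⋃ ℓ ∈ Λ.erase ℓs, Gl (Bl ℓ) := by
      intro ω hω
      obtain ⟨ℓ, hℓ, hne', hmem⟩ := hkey hyA ω hω
      exact mem_iUnion₂.2 ⟨ℓ, Finset.mem_erase.2 ⟨fun h => hne' (h.trans hcy.symm), hℓ⟩, hmem⟩
    calc μ.real (L \ R) ≤ μ.real ((L \ R) ∩ G ∪ Gᶜ) := measureReal_mono fun ω hω => by
            by_cases h : ω ∈ G
            · exact Or.inl ⟨hω, h⟩
            · exact Or.inr h
      _ ≤ μ.real ((L \ R) ∩ G) + μ.real Gᶜ := measureReal_union_le _ _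
      _ ≤ μ.real (⋃ ℓ ∈ Λ.erase ℓs, Gl (Bl ℓ)) + 0 := by
          rw [hGc]; exact add_le_add (measureReal_mono hsub (measure_ne_top _ _)) le_rfl
      _ ≤ ∑ ℓ ∈ Λ.erase ℓs, μ.real (Gl (Bl ℓ)) := by
          rw [add_zero]; exact measureReal_biUnion_finset_le _ _
  -- `t - μ(G_{ℓs}) ≤ μ(R \ L)`
  have hcore : (D (Bl ℓs) ∩ Q (Bl ℓs)) \ Gl (Bl ℓs) ⊆ R \ L := by
    intro ω hω
    obtain ⟨⟨hDω, hQω⟩, hGω⟩ := hω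
    have hoB : ∀ b' ∈ Bl ℓs, ω ∉ (openConn o b' : Set (BondConfig (Fin n))) :=
      fun b' hb' hob' => hGω ⟨⟨⟨b', hb', hob'⟩, hDω⟩, hQω⟩
    constructor
    · -- `π(y) ⊆ B_{ℓs}`
      show (A.filter fun x => ω ∈ openConn y x).card ≤ j
      have hsub : (A.filter fun x => ω ∈ openConn y x) ⊆ Bl ℓs := by
        intro x hx
        obtain ⟨hxA, hyx⟩ := Finset.mem_filter.1 hx
        by_contra hxB
        exact hDω y hy x (Finset.mem_sdiff.2 ⟨hxA, hxB⟩) hyx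
      exact le_trans (Finset.card_le_card hsub) hlight
    · -- `N ∈ {0} ∪ (j, ∞)`
      rintro ⟨h1, hj⟩
      obtain ⟨a₀, ha₀⟩ := Finset.card_pos.1 (by omega : 0 < (A.filter fun x => ω ∈ openConn o x).card)
      obtain ⟨ha₀A, hoa₀⟩ := Finset.mem_filter.1 ha₀
      have ha₀B : a₀ ∉ Bl ℓs := fun h => hoB a₀ h hoa₀
      have ha₀' : a₀ ∈ A \ Bl ℓs := Finset.mem_sdiff.2 ⟨ha₀A, ha₀B⟩
      have hoa₀' : (openGraph ω).Reachable o a₀ := hoa₀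
      -- `o` holds all of `A \ B_{ℓs}`
      have hsub : A \ Bl ℓs ⊆ (A.filter fun x => ω ∈ openConn o x) := by
        intro x hx
        refine Finset.mem_filter.2 ⟨(Finset.mem_sdiff.1 hx).1, ?_⟩
        have hxx : (openGraph ω).Reachable a₀ x :=
          hQω a₀ (Finset.mem_coe.2 ha₀') x (Finset.mem_coe.2 hx)
        exact hoa₀'.trans hxx
      have hcard : (A \ Bl ℓs).card ≤ (A.filter fun x => ω ∈ openConn o x).card :=
        Finset.card_le_card hsub
      have hBs : Bl ℓs ⊆ A := Finset.filter_subset _ _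
      have hc0 : (A \ Bl ℓs).card = A.card - (Bl ℓs).card := Finset.card_sdiff_of_subset hBs
      have hm0 : (Bl ℓs).card ≤ A.card := Finset.card_le_card hBs
      omega
  have hRL : t - μ.real (Gl (Bl ℓs)) ≤ μ.real (R \ L) := by
    have hGsub : Gl (Bl ℓs) ⊆ D (Bl ℓs) ∩ Q (Bl ℓs) := fun ω hω => ⟨hω.1.2, hω.2⟩
    rw [ht, ← measureReal_sdiff hGsub MeasurableSet.of_discrete]
    exact measureReal_mono hcore
  have hsplit : ∑ ℓ ∈ Λ, μ.real (Gl (Bl ℓ)) =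
      ∑ ℓ ∈ Λ.erase ℓs, μ.real (Gl (Bl ℓ)) + μ.real (Gl (Bl ℓs)) := by
    rw [← Finset.sum_erase_add _ _ hℓs]
  have hL_eq : μ.real L = μ.real (L ∩ R) + μ.real (L \ R) :=
    (measureReal_inter_add_sdiff (μ := μ) (s := L) (t := R) MeasurableSet.of_discrete).symm
  have hR_eq : μ.real R = μ.real (R ∩ L) + μ.real (R \ L) :=
    (measureReal_inter_add_sdiff (μ := μ) (s := R) (t := L) MeasurableSet.of_discrete).symm
  rw [hL_eq, hR_eq, inter_comm R L]
  linarith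

/-- **CIL at every level `j ≥ |A| − 2`, for every relay set** (the registered signature of
`stub_cumulativeIsolation` with the extra hypothesis `A.card ≤ j + 2`): singleton blobs in
`cumulativeIsolation_blobs_coLightPairs`.  New for `|A| ≥ 5` at `j = |A| − 2`; together with
`Theorems.lonelyRelay` (`j = 1`) the open levels of CIL are `2 ≤ j ≤ |A| − 3`.
[cite: KozmaNitzan2024, Lemmas 1–2 (pp. 5–6); VandenbergHaggstromKahn2005, Thms. 1.3, 1.5] -/
theorem cumulativeIsolation_level_ge_card_sub_two :
    ∀ (n : ℕ) (w : Sym2 (Fin n) → unitInterval) (A : Finset (Fin n)) (o : Fin n) (j : ℕ),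
      A.card ≤ j + 2 → A.Nonempty → ∃ a ∈ A,
        (Literature.Probability.LatticeModels.prodBernoulli w).real
            {ω : Literature.Probability.Percolation.BondConfig (Fin n) |
              1 ≤ (A.filter fun x => ω ∈ Literature.Probability.Percolation.openConn o x).card ∧
                (A.filter fun x => ω ∈ Literature.Probability.Percolation.openConn o x).card ≤ j} ≤
          (Literature.Probability.LatticeModels.prodBernoulli w).real
            {ω : Literature.Probability.Percolation.BondConfig (Fin n) |
              (A.filter fun x => ω ∈ Literature.Probability.Percolation.openConn a x).card ≤ j} := by
  intro n w A o j hAj hA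
  refine cumulativeIsolation_blobs_coLightPairs w A o j (fun v : Fin n => v) (fun u _ v _ huv => ?_)
    (fun ℓ ℓ' hne hℓ hℓ' => ?_) hA
  · subst huv
    have h : (openConn u u : Set (BondConfig (Fin n)))ᶜ = ∅ := by
      ext ω
      simp only [mem_compl_iff, mem_empty_iff_false, iff_false, not_not]
      exact (SimpleGraph.Reachable.refl u : (openGraph ω).Reachable u u)
    rw [h, measureReal_empty]
  · obtain ⟨a, ha⟩ := hℓ
    obtain ⟨a', ha'⟩ := hℓ'
    have h1 : 1 ≤ (A.filter fun x => x = ℓ).card := Finset.card_pos.2 ⟨a, ha⟩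
    have h2 : 1 ≤ (A.filter fun x => x = ℓ').card := Finset.card_pos.2 ⟨a', ha'⟩
    omega

end Summit.CriticalPhenomena.PercolationContinuityZ3.Theorems

end
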